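import Literature.AnabelianGeometry.EtaleTheta.ThetaCoversTemperedOfHuuSection
import Literature.AnabelianGeometry.EtaleTheta.SettingModelChiCuspSectionData
import HarnessLib

/-!
# [EtTh] §2, R312 «ORBIT-EMBEDDING (map_Huu) @ the model» WITNESSED WITH RESIDUAL ∅ at the KUMMER-carrying cusped
# inversion model `χ′`

S. Mochizuki, *The étale theta function and its Frobenioid-theoretic manifestations*, Publ. RIMS **45** (2009) [EtTh], §2:
Def. 2.1 p. 35, Prop. 2.2 pp. 36–38, Def. 2.3 p. 38, Def. 2.5 (i) p. 39, Def. 2.7 p. 41 [cite: MochizukiEtTh2009, Def 2.7 p.41].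
Cell abc-iut, layer L2, seat abc-iut-L2-t10 (gen 6), row «R312 CAPSTONE AT χ′» — PROOF-ONLY (0 definitions).

The chain, every link a construction/theorem in the tree: abc-iut-w5-d140's `MuTwoSetting.inversionModelχ′` (`Π^tp_C := Π^tp_X ⋊_ι ℤ/2`
over the cusped χ-model, `ε_±`-conjugation = `twistedInversion χ`) · THE profinite completion `CLevelData.toPiCHat` · the SECTION cusp
datum `PiCData.coverDataAxOfSection` (this seat, `D_x := Δ̄_Θ-preimage · incl(toHat(inr G_K))`) · abc-iut-L2-d3's assembly
`temperedCoverDataOfHuuOfSection` / `orbitEmbeddingOfHuuOfSection` (`map_Huu` AS A THEOREM) · G-L2d3-7 at `χ′`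
(`barKerTp_le_Huuχ_inversionModelχ'`, from abc-iut-L2-t8/L2-d1's `barKerTp_le_Huuχ`) · `IotaStable` (abc-iut-L2-d1's
`map_Huuχ_twistedInversion`) · and NOW the §1/§2 DATA at `χ′` (`SettingModelChiCuspSectionData`): `E :=` the étale-theta datum over
the section Kummer datum `kummerDataχ′Sec` carrying the model's own class `η̈^Θ = etaDdχ ≠ 1`, `C := doubleUnderlineχ′Sec`
(`Π^tp_{X̲̲} = Huuχ p l`), `τ := τ′ := nonCuspidalPointχ′`:

* **`exists_orbitEmbedding_inversionModelχ'`** — for every odd `l`: `∃ E C T, E.toKummerData = kummerDataχ′Sec p ∧ E.etaDd ≠ 1 ∧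
  C.Huu = Huuχ p l ∧ T.Gtp = (inversionModelχ′ p).GtpC ∧ Nonempty (C.OrbitEmbedding T)` — abc-iut-L2-t2's `OrbitEmbedding`
  INHABITED at a model WITH (non-trivial) étale-theta data, NO residual binder;
* `nonempty_orbitEmbedding_doubleUnderlineχ'Sec` — the same for THE named data (`C := doubleUnderlineχ′Sec p l hodd`, points
  `nonCuspidalPointχ′`).

HONEST LIMITS: SYNTHETIC mod-`l` cusp datum (the Galois section's `D̄_x`-preimage, not the decomposition group of the model's toral
cusp); the two Def. 1.9 points are taken EQUAL (`τ = τ′ := nonCuspidalPointχ′` — `OrbitEmbedding` carries them as free DATA; the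
`Ü(τ^{±1}) = (√−1)^{±1}` normalisation of Def. 1.9 is the cell's `MuTwoSetting.AnchoredStandardData`, not this structure); semi-synthetic model =
consistency evidence for the typed interface only; nothing of [EtTh] asserted; no side taken on [IUTchIII] Cor. 3.12; typed ≠ proved;
instantiated ≠ endorsed.
-/

noncomputable section

namespace Literature.AnabelianGeometry.EtaleTheta.SettingModel

open Literature.AnabelianGeometry.SemiGraphs ThetaCovers ThetaSetting

variable (p : ℕ) [Fact p.Prime]

/-- **`OrbitEmbedding C T` for THE named data at `χ′`**: `C := doubleUnderlineχ′Sec p l hodd` (over the datum carrying `η̈^Θ = etaDdχ`),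
`τ := τ′ := nonCuspidalPointχ′`, `T` on THE `Π^tp_C` of `inversionModelχ′`. [cite: MochizukiEtTh2009, Def 2.7 p.41] -/
theorem nonempty_orbitEmbedding_doubleUnderlineχ'Sec (l : ℕ+) (hodd : Odd (l : ℕ)) :
    ∃ T : TemperedCoverData.{0} l, T.Gtp = (MuTwoSetting.inversionModelχ' p).GtpC ∧
      Nonempty ((doubleUnderlineχ'Sec p l hodd).OrbitEmbedding T) :=
  nonempty_orbitEmbedding_inversionModelχ'_of_Huu_eq p hodd (doubleUnderlineχ'Sec p l hodd) rfl
    (nonCuspidalPointχ' p) (nonCuspidalPointχ' p)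

/-- **R312 «ORBIT-EMBEDDING (map_Huu) @ the model» — RESIDUAL ∅.** At the Kummer-carrying cusped inversion model `χ′`, for every
odd `l`, there are an étale-theta datum `E` over `modelχ′` with `E.toKummerData = kummerDataχ′Sec p` and NON-TRIVIAL class
`η̈^Θ`, a choice `X̲̲` with `Π^tp_{X̲̲} = Huuχ p l`, and a `TemperedCoverData` on THE `Π^tp_C` of `inversionModelχ′` for which
abc-iut-L2-t2's `OrbitEmbedding C T` is INHABITED. [cite: MochizukiEtTh2009, Def 2.7 p.41] -/
theorem exists_orbitEmbedding_inversionModelχ' (l : ℕ+) (hodd : Odd (l : ℕ)) :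
    ∃ (E : (ThetaSetting.modelχ' p).EtaleThetaData) (C : E.DoubleUnderline (l : ℕ)) (T : TemperedCoverData.{0} l),
      E.toKummerData = kummerDataχ'Sec p ∧ E.etaDd ≠ 1 ∧ C.Huu = Huuχ p l ∧
        T.Gtp = (MuTwoSetting.inversionModelχ' p).GtpC ∧ Nonempty (C.OrbitEmbedding T) := by
  obtain ⟨T, hT, hne⟩ := nonempty_orbitEmbedding_doubleUnderlineχ'Sec p l hodd
  exact ⟨_, doubleUnderlineχ'Sec p l hodd, T, rfl, etaDdχ_ne_one p, rfl, hT, hne⟩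

end Literature.AnabelianGeometry.EtaleTheta.SettingModel

end
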